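import Literature.Computability.QuantumComplexity.ExactCompilerInstances
import Literature.Computability.QuantumComplexity.ExactCompilerLevelCorrect
import Literature.Computability.QuantumComplexity.SU2DensityNet
import HarnessLib

/-!
# The exact braid compiler: existence of the hardwired parameters (net and seed)

Topic `Literature/Computability/QuantumComplexity`; sequel of `ExactCompilerInstances.lean`. The
compiler of the Jones-hardness reduction is parameterised by a finite NET of words (a `1/200`-net
of `SU(2)`) and a SEED word `c₀` of chord in `[1/25, 3/50]`; the reduction machine has them
hardwired, and since a Karp reduction is an existential (`∃ f ∈ FP, …`) it suffices to prove they
EXIST, which this file does for both instances from the density theorems (Aharonov–Arad 2011 §4,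
our `OneQubitBraidDensity`/`TwoQubitGadgetDensity`) and compactness (`SU2DensityNet`):

* `wordCand E w` — the candidate of a word (matrix and inverse word), well formed; `netOf E l` —
  all words of length `≤ l`; `isNet_netOf` — a uniform word-approximation bound makes it a net;
* `exists_isNet₁`, `exists_seed₁` (one-qubit), `exists_isNet₂`, `exists_seed₂` (gadget).

## References

* D. Aharonov, I. Arad, New J. Phys. 13 (2011) 035019, §3.3, §4 [AharonovArad2011].
* C. M. Dawson, M. A. Nielsen, QIC 6 (2006), §3 [DawsonNielsen2006].
-/

noncomputable section

open scoped Matrix.Norms.L2Operator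

namespace Literature.Computability.QuantumComplexity

open Matrix Complex QuadraticAlgebra

local notation "SU2" => Matrix.specialUnitaryGroup (Fin 2) ℂ
local notation "M2" => Matrix (Fin 2) (Fin 2) ℂ
local notation "U2" => Matrix.unitaryGroup (Fin 2) ℂ

namespace ExactCompiler

variable (E : EvalSpec Letter)

/-! ### Words as candidates -/

/-- `inv` is an involution. [folklore] -/
@[simp] theorem Letter.inv_inv (γ : Letter) : γ.inv.inv = γ := by cases γ <;> rfl

/-- The generators are inverse to their inverse letters (a property of an evaluation instance). [folklore] -/
structure InvLaw : Prop where
  /-- `mat₀ γ · mat₀ γ⁻¹ = 1` -/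
  law : ∀ γ : Letter, E.mat₀ γ * E.mat₀ γ.inv = 1

/-- The inverse word: reversed, letters inverted. [folklore] -/
def invWord (w : List Letter) : List Letter := (w.map Letter.inv).reverse

/-- **The candidate of a word.** [folklore] -/
def wordCand (w : List Letter) : Cand Letter :=
  ⟨w, (w.map E.mat₀).prod, invWord w, ((invWord w).map E.mat₀).prod⟩

/-- Both-sided inverse law. [folklore] -/
theorem invLaw' (h : InvLaw E) (γ : Letter) : E.mat₀ γ.inv * E.mat₀ γ = 1 := by
  have := h.law γ.inv; rwa [Letter.inv_inv] at this

/-- A word times its inverse word. [folklore] -/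
theorem prod_mul_prod_invWord (h : InvLaw E) : ∀ w : List Letter,
    (w.map E.mat₀).prod * ((invWord w).map E.mat₀).prod = 1
  | [] => by simp [invWord]
  | γ :: w => by
    have ih := prod_mul_prod_invWord h w
    simp only [invWord, List.map_cons, List.reverse_cons, List.map_append, List.prod_append, List.prod_cons,
      List.prod_nil, List.map_nil, mul_one] at ih ⊢
    rw [Matrix.mul_assoc, ← Matrix.mul_assoc ((w.map E.mat₀).prod), ih, Matrix.one_mul, h.law γ]

/-- An inverse word times its word. [folklore] -/
theorem prod_invWord_mul_prod (h : InvLaw E) : ∀ w : List Letter,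
    ((invWord w).map E.mat₀).prod * (w.map E.mat₀).prod = 1
  | [] => by simp [invWord]
  | γ :: w => by
    have ih := prod_invWord_mul_prod h w
    simp only [invWord, List.map_cons, List.reverse_cons, List.map_append, List.prod_append, List.prod_cons,
      List.prod_nil, List.map_nil, mul_one] at ih ⊢
    rw [Matrix.mul_assoc, ← Matrix.mul_assoc (E.mat₀ γ.inv), invLaw' E h, Matrix.one_mul, ih]

/-- **Word candidates are well formed.** [folklore] -/
theorem wf_wordCand (h : InvLaw E) (w : List Letter) : (wordCand E w).WF E.mat₀ :=
  ⟨rfl, rfl, prod_mul_prod_invWord E h w, prod_invWord_mul_prod E h w⟩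

/-- Evaluation of a concatenation. [folklore] -/
theorem evS_wordCand_append (h : InvLaw E) (u v : List Letter) :
    evS E (wordCand E (u ++ v)) (wf_wordCand E h _) = evS E (wordCand E u) (wf_wordCand E h _) * evS E (wordCand E v) (wf_wordCand E h _) :=
  Subtype.ext (by simp [wordCand, E.evM_mul])

/-- Evaluation of a single letter. [folklore] -/
theorem coe_evS_wordCand_singleton (h : InvLaw E) (γ : Letter) :
    ((evS E (wordCand E [γ]) (wf_wordCand E h _) : SU2) : M2) = E.evM (E.mat₀ γ) := by
  simp [wordCand]

/-! ### All words of bounded length -/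

/-- All words of length exactly `l`. [folklore] -/
def wordsLen : ℕ → List (List Letter)
  | 0 => [[]]
  | l + 1 => (wordsLen l).flatMap fun w => [Letter.x, Letter.y, Letter.xi, Letter.yi].map fun γ => w ++ [γ]

/-- **All words of length `≤ l`** (the net of the machine). [folklore] -/
def netOf (l : ℕ) : List (Cand Letter) := ((List.range (l + 1)).flatMap wordsLen).map (wordCand E)

/-- Every word of length `l` is listed. [folklore] -/
theorem mem_wordsLen : ∀ (l : ℕ) (w : List Letter), w.length = l → w ∈ wordsLen l
  | 0, w, hw => by rw [List.length_eq_zero_iff.1 hw]; simp [wordsLen]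
  | l + 1, w, hw => by
    obtain ⟨u, γ, rfl⟩ : ∃ u γ, w = u ++ [γ] := by
      rcases List.eq_nil_or_concat w with h | ⟨u, γ, h⟩
      · subst h; simp at hw
      · exact ⟨u, γ, by rw [h, List.concat_eq_append]⟩
    rw [List.length_append, List.length_singleton] at hw
    have hu := mem_wordsLen l u (by omega)
    rw [wordsLen, List.mem_flatMap]
    exact ⟨u, hu, by cases γ <;> simp⟩

/-- Every word of length `≤ l` gives a member of the net. [folklore] -/
theorem wordCand_mem_netOf {l : ℕ} {w : List Letter} (hw : w.length ≤ l) : wordCand E w ∈ netOf E l := by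
  unfold netOf
  refine List.mem_map.2 ⟨w, List.mem_flatMap.2 ⟨w.length, List.mem_range.2 (by omega), mem_wordsLen _ w rfl⟩, rfl⟩

/-- Members of the net are word candidates. [folklore] -/
theorem exists_eq_wordCand_of_mem_netOf {l : ℕ} {a : Cand Letter} (ha : a ∈ netOf E l) : ∃ w, a = wordCand E w := by
  unfold netOf at ha
  obtain ⟨w, _, rfl⟩ := List.mem_map.1 ha
  exact ⟨w, rfl⟩

/-- The net consists of well-formed candidates. [folklore] -/
theorem allWF_netOf (h : InvLaw E) (l : ℕ) : AllWF E (netOf E l) := by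
  intro a ha
  obtain ⟨w, rfl⟩ := exists_eq_wordCand_of_mem_netOf E ha
  exact wf_wordCand E h w

/-- The net is nonempty (it contains the empty word). [folklore] -/
theorem netOf_ne_nil (l : ℕ) : netOf E l ≠ [] := by
  intro h
  have := wordCand_mem_netOf E (w := []) (l := l) (by simp)
  rw [h] at this; simp at this

/-! ### From uniform word approximation to `IsNet` -/

/-- The generators as a subset of `SU(2)`. [folklore] -/
def genSet (h : InvLaw E) : Set SU2 := {U | ∃ γ, U = evS E (wordCand E [γ]) (wf_wordCand E h _)}

/-- Lifting a list over the generators to a word. [folklore] -/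
theorem exists_word_of_forall_mem_genSet (h : InvLaw E) : ∀ w' : List SU2, (∀ a ∈ w', a ∈ genSet E h) →
    ∃ w : List Letter, w.length = w'.length ∧ evS E (wordCand E w) (wf_wordCand E h _) = w'.prod
  | [], _ => ⟨[], rfl, Subtype.ext (by simp [wordCand, E.evM_one])⟩
  | a :: w', hall => by
    obtain ⟨γ, rfl⟩ := hall a (by simp)
    obtain ⟨w, hlen, hw⟩ := exists_word_of_forall_mem_genSet h w' (fun b hb => hall b (by simp [hb]))
    refine ⟨γ :: w, by simp [hlen], ?_⟩
    rw [List.prod_cons, ← hw, show γ :: w = [γ] ++ w from rfl, evS_wordCand_append E h]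

/-- **A uniform bound makes the net.** If every `U ∈ SU(2)` is within `1/200` of a product of
`≤ l₀` generators, then `netOf E l₀` is a net. [cite: AharonovArad2011, §3.3] -/
theorem isNet_netOf (h : InvLaw E) {l₀ : ℕ} (happrox : ∀ U : SU2, SolovayKitaev.WordApprox (genSet E h) l₀ (1 / 200) U) :
    IsNet E (netOf E l₀) := by
  refine ⟨allWF_netOf E h l₀, fun U => ?_⟩
  obtain ⟨w', hw', hlen, hnorm⟩ := happrox U
  obtain ⟨w, hwlen, hw⟩ := exists_word_of_forall_mem_genSet E h w' hw'
  refine ⟨wordCand E w, wordCand_mem_netOf E (by rw [hwlen]; exact hlen), wf_wordCand E h w, ?_⟩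
  rw [hw, norm_sub_rev]; exact hnorm

/-! ### From a good approximation of `D(1/20)` to a seed -/

/-- The chord of `D(1/20)` lies in `[0.045, 0.05]`. [folklore] -/
theorem chord_torus_one_div_twenty :
    (45 / 1000 : ℝ) ≤ ‖(1 : M2) - ((torus (1 / 20) : SU2) : M2)‖ ∧ ‖(1 : M2) - ((torus (1 / 20) : SU2) : M2)‖ ≤ 1 / 20 := by
  have h := norm_one_sub_torus_sq (1 / 20)
  have hn := norm_nonneg ((1 : M2) - ((torus (1 / 20) : SU2) : M2))
  have hc := cos_le_taylor (x := (1 / 20 : ℝ)) (by rw [abs_of_nonneg (by norm_num)]; norm_num)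
  have hu := norm_one_sub_torus_le (1 / 20 : ℝ)
  rw [abs_of_nonneg (by norm_num)] at hu
  refine ⟨?_, hu⟩
  nlinarith

/-- **A word within `1/1000` of `D(1/20)` is a seed**: its chord is in `[1/25, 3/50]`. [folklore] -/
theorem seed_of_near (h : InvLaw E) {w : List Letter}
    (hw : ‖((evS E (wordCand E w) (wf_wordCand E h _) : SU2) : M2) - ((torus (1 / 20) : SU2) : M2)‖ < 1 / 1000) :
    1 / 25 ≤ chord E (wordCand E w) (wf_wordCand E h _) ∧ chord E (wordCand E w) (wf_wordCand E h _) ≤ 3 / 50 := by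
  obtain ⟨hlo, hhi⟩ := chord_torus_one_div_twenty
  have t1 := norm_sub_le_norm_sub_add_norm_sub (1 : M2) ((torus (1 / 20) : SU2) : M2) ((evS E (wordCand E w) (wf_wordCand E h _) : SU2) : M2)
  have t2 := norm_sub_le_norm_sub_add_norm_sub (1 : M2) ((evS E (wordCand E w) (wf_wordCand E h _) : SU2) : M2) ((torus (1 / 20) : SU2) : M2)
  rw [norm_sub_rev ((torus (1 / 20) : SU2) : M2)] at t1
  unfold chord
  constructor <;> linarith

/-! ### The one-qubit instance -/

/-- Inverse law of the one-qubit generators. [folklore] -/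
theorem invLaw₁ : InvLaw E₁ := by
  constructor
  intro γ; cases γ
  · exact X1K_mul_adjK
  · exact Y1K_mul_adjK
  · exact adjK_mul_of_mul_adjK X1K_mul_adjK
  · exact adjK_mul_of_mul_adjK Y1K_mul_adjK

/-- The generator set of the one-qubit instance is `pairGen X1U Y1U`. [folklore] -/
theorem genSet₁_eq : genSet E₁ invLaw₁ = pairGen X1U Y1U X1U_det Y1U_det := by
  ext U
  simp only [genSet, pairGen, Set.mem_setOf_eq, Set.mem_insert_iff, Set.mem_singleton_iff]
  have ex : ∀ γ, ((evS E₁ (wordCand E₁ [γ]) (wf_wordCand E₁ invLaw₁ _) : SU2) : M2) = (mat₁ γ).map K5.toComplex :=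
    fun γ => by rw [coe_evS_wordCand_singleton E₁ invLaw₁]; rfl
  have hx : evS E₁ (wordCand E₁ [Letter.x]) (wf_wordCand E₁ invLaw₁ _) = toSU2 X1U X1U_det := Subtype.ext (by rw [ex]; rfl)
  have hy : evS E₁ (wordCand E₁ [Letter.y]) (wf_wordCand E₁ invLaw₁ _) = toSU2 Y1U Y1U_det := Subtype.ext (by rw [ex]; rfl)
  have hxi : evS E₁ (wordCand E₁ [Letter.xi]) (wf_wordCand E₁ invLaw₁ _) = (toSU2 X1U X1U_det)⁻¹ :=
    Subtype.ext (by rw [ex, SolovayKitaev.coe_inv]; change (K5.adjK X1K).map K5.toComplex = star (X1K.map K5.toComplex); exact K5.map_adjK X1K)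
  have hyi : evS E₁ (wordCand E₁ [Letter.yi]) (wf_wordCand E₁ invLaw₁ _) = (toSU2 Y1U Y1U_det)⁻¹ :=
    Subtype.ext (by rw [ex, SolovayKitaev.coe_inv]; change (K5.adjK Y1K).map K5.toComplex = star (Y1K.map K5.toComplex); exact K5.map_adjK Y1K)
  constructor
  · rintro ⟨γ, rfl⟩
    cases γ
    · exact Or.inl hx
    · exact Or.inr (Or.inl hy)
    · exact Or.inr (Or.inr (Or.inl hxi))
    · exact Or.inr (Or.inr (Or.inr hyi))
  · rintro (rfl | rfl | rfl | rfl)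
    · exact ⟨Letter.x, hx.symm⟩
    · exact ⟨Letter.y, hy.symm⟩
    · exact ⟨Letter.xi, hxi.symm⟩
    · exact ⟨Letter.yi, hyi.symm⟩

/-- The four hypotheses of the density criterion for `X1U, Y1U`. [cite: AharonovArad2011, §4] -/
theorem criterion₁ :
    ((X1U : U2) : M2).trace ^ 2 = K5.toComplex (2 + K5.ofPhi ⟨3, -3⟩) * ((X1U : U2) : M2).det ∧
    (∀ μ : ℂ, μ + μ⁻¹ = K5.toComplex (2 + K5.ofPhi ⟨3, -3⟩) - 2 → ∀ m : ℕ, 0 < m → μ ^ m ≠ 1) ∧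
    Y1U * X1U ≠ X1U * Y1U ∧
    ((Y1U : U2) : M2) * X1U * star ((Y1U : U2) : M2) ≠ ((X1U : U2) : M2).det • star ((X1U : U2) : M2) := by
  refine ⟨?_, ?_, ?_, ?_⟩
  · change (X1K.map K5.toComplex).trace ^ 2 = _ * (X1K.map K5.toComplex).det
    rw [K5.trace_mapK, K5.det_mapK, sq, ← map_mul, ← map_mul, X1K_trace_sq]
  · intro μ hμ m hm
    refine pow_ne_one_of_add_inv_eq_toReal (c := ⟨3, -3⟩) ?_ two_lt_toConj_three hm
    rw [hμ, map_add, K5.toComplex_ofPhi, map_ofNat]; ring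
  · intro h
    have e := congrArg (fun U : U2 => (U : M2)) h
    simp only [Submonoid.coe_mul] at e
    change Y1K.map K5.toComplex * X1K.map K5.toComplex = X1K.map K5.toComplex * Y1K.map K5.toComplex at e
    rw [← K5.map_mulK, ← K5.map_mulK] at e
    exact Y1K_mul_X1K_ne (K5.map_injective e)
  · intro h
    rw [X1U_det, one_smul] at h
    change Y1K.map K5.toComplex * X1K.map K5.toComplex * star (Y1K.map K5.toComplex) = star (X1K.map K5.toComplex) at h
    rw [← K5.map_adjK, ← K5.map_adjK, ← K5.map_mulK, ← K5.map_mulK] at h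
    exact Y1K_conj_X1K_ne (K5.map_injective h)

/-- **The one-qubit net exists.** [cite: AharonovArad2011, §3.3] -/
theorem exists_isNet₁ : ∃ l₀ : ℕ, IsNet E₁ (netOf E₁ l₀) := by
  obtain ⟨htr, hroot, hcomm, hconj⟩ := criterion₁
  obtain ⟨l₀, hl₀⟩ := exists_length_forall_wordApprox_pair X1U Y1U X1U_det Y1U_det _ htr hroot hcomm hconj
    (ε₀ := 1 / 200) (by norm_num)
  refine ⟨l₀, isNet_netOf E₁ invLaw₁ fun U => ?_⟩
  rw [genSet₁_eq]; exact hl₀ U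

/-- **The one-qubit seed exists.** [cite: AharonovArad2011, §3.3] -/
theorem exists_seed₁ : ∃ w : List Letter,
    1 / 25 ≤ chord E₁ (wordCand E₁ w) (wf_wordCand E₁ invLaw₁ _) ∧ chord E₁ (wordCand E₁ w) (wf_wordCand E₁ invLaw₁ _) ≤ 3 / 50 := by
  obtain ⟨htr, hroot, hcomm, hconj⟩ := criterion₁
  have hA : ((su2ToU2 (torus (1 / 20)) : U2) : M2).det = 1 := (Matrix.mem_specialUnitaryGroup_iff.1 (torus (1 / 20)).2).2
  obtain ⟨w', hw', hnorm⟩ := exists_word_near_of_det_eq_one X1U Y1U _ htr hroot hcomm hconj (su2ToU2 (torus (1 / 20))) hA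
    (ε := 1 / 1000) (by norm_num)
  -- lift the `U(2)`-word to letters
  have hlift : ∀ w' : List U2, (∀ a ∈ w', a ∈ ({X1U, Y1U, X1U⁻¹, Y1U⁻¹} : Set U2)) →
      ∃ w : List Letter, ((evS E₁ (wordCand E₁ w) (wf_wordCand E₁ invLaw₁ _) : SU2) : M2) = ((w'.prod : U2) : M2) := by
    intro w'
    induction w' with
    | nil => intro; exact ⟨[], by simp [wordCand, E₁]⟩
    | cons a w' ih =>
      intro hall
      obtain ⟨w, hw⟩ := ih (fun b hb => hall b (by simp [hb]))
      have ha := hall a (by simp)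
      simp only [Set.mem_insert_iff, Set.mem_singleton_iff] at ha
      have ex : ∀ γ, ((evS E₁ (wordCand E₁ (γ :: w)) (wf_wordCand E₁ invLaw₁ _) : SU2) : M2) =
          (mat₁ γ).map K5.toComplex * ((evS E₁ (wordCand E₁ w) (wf_wordCand E₁ invLaw₁ _) : SU2) : M2) := by
        intro γ
        rw [show γ :: w = [γ] ++ w from rfl, evS_wordCand_append E₁ invLaw₁, Submonoid.coe_mul, coe_evS_wordCand_singleton E₁ invLaw₁]; rfl
      rcases ha with rfl | rfl | rfl | rfl
      · exact ⟨Letter.x :: w, by rw [ex, hw, List.prod_cons, Submonoid.coe_mul]; rfl⟩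
      · exact ⟨Letter.y :: w, by rw [ex, hw, List.prod_cons, Submonoid.coe_mul]; rfl⟩
      · exact ⟨Letter.xi :: w, by rw [ex, hw, List.prod_cons, Submonoid.coe_mul, Matrix.UnitaryGroup.inv_apply]; exact congrArg (· * _) (K5.map_adjK X1K)⟩
      · exact ⟨Letter.yi :: w, by rw [ex, hw, List.prod_cons, Submonoid.coe_mul, Matrix.UnitaryGroup.inv_apply]; exact congrArg (· * _) (K5.map_adjK Y1K)⟩
  obtain ⟨w, hw⟩ := hlift w' hw'
  refine ⟨w, seed_of_near E₁ invLaw₁ ?_⟩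
  rw [hw]; exact hnorm

/-! ### The gadget instance -/

/-- Inverse law of the gadget generators. [folklore] -/
theorem invLaw₂ : InvLaw E₂ := by
  constructor
  intro γ; cases γ
  · exact Gadget.X2K_mul_inv
  · exact Gadget.Y2K_mul_inv
  · exact Gadget.X2invK_mul
  · exact Gadget.Y2invK_mul

/-- The generator set of the gadget instance is `pairGen X2U Y2U`. [folklore] -/
theorem genSet₂_eq : genSet E₂ invLaw₂ = pairGen Gadget.X2U Gadget.Y2U Gadget.X2U_det Gadget.Y2U_det := by
  ext U
  simp only [genSet, pairGen, Set.mem_setOf_eq, Set.mem_insert_iff, Set.mem_singleton_iff]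
  have ex : ∀ γ, ((evS E₂ (wordCand E₂ [γ]) (wf_wordCand E₂ invLaw₂ _) : SU2) : M2) = Gadget.tildeOf (mat₂ γ) :=
    fun γ => by rw [coe_evS_wordCand_singleton E₂ invLaw₂]; rfl
  have hx : evS E₂ (wordCand E₂ [Letter.x]) (wf_wordCand E₂ invLaw₂ _) = toSU2 Gadget.X2U Gadget.X2U_det := Subtype.ext (by rw [ex]; rfl)
  have hy : evS E₂ (wordCand E₂ [Letter.y]) (wf_wordCand E₂ invLaw₂ _) = toSU2 Gadget.Y2U Gadget.Y2U_det := Subtype.ext (by rw [ex]; rfl)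
  have hxi : evS E₂ (wordCand E₂ [Letter.xi]) (wf_wordCand E₂ invLaw₂ _) = (toSU2 Gadget.X2U Gadget.X2U_det)⁻¹ :=
    Subtype.ext (by rw [ex, SolovayKitaev.coe_inv]; exact (Gadget.star_tildeOf_eq Gadget.X2U.2 Gadget.X2K_mul_inv).symm)
  have hyi : evS E₂ (wordCand E₂ [Letter.yi]) (wf_wordCand E₂ invLaw₂ _) = (toSU2 Gadget.Y2U Gadget.Y2U_det)⁻¹ :=
    Subtype.ext (by rw [ex, SolovayKitaev.coe_inv]; exact (Gadget.star_tildeOf_eq Gadget.Y2U.2 Gadget.Y2K_mul_inv).symm)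
  constructor
  · rintro ⟨γ, rfl⟩
    cases γ
    · exact Or.inl hx
    · exact Or.inr (Or.inl hy)
    · exact Or.inr (Or.inr (Or.inl hxi))
    · exact Or.inr (Or.inr (Or.inr hyi))
  · rintro (rfl | rfl | rfl | rfl)
    · exact ⟨Letter.x, hx.symm⟩
    · exact ⟨Letter.y, hy.symm⟩
    · exact ⟨Letter.xi, hxi.symm⟩
    · exact ⟨Letter.yi, hyi.symm⟩

/-- The four hypotheses of the density criterion for `X2U, Y2U`. [cite: AharonovArad2011, §4] -/
theorem criterion₂ :
    ((Gadget.X2U : U2) : M2).trace ^ 2 = K5.toComplex (2 + K5.ofPhi ⟨11, -8⟩) * ((Gadget.X2U : U2) : M2).det ∧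
    (∀ μ : ℂ, μ + μ⁻¹ = K5.toComplex (2 + K5.ofPhi ⟨11, -8⟩) - 2 → ∀ m : ℕ, 0 < m → μ ^ m ≠ 1) ∧
    Gadget.Y2U * Gadget.X2U ≠ Gadget.X2U * Gadget.Y2U ∧
    ((Gadget.Y2U : U2) : M2) * Gadget.X2U * star ((Gadget.Y2U : U2) : M2) ≠
      ((Gadget.X2U : U2) : M2).det • star ((Gadget.X2U : U2) : M2) := by
  refine ⟨?_, ?_, ?_, ?_⟩
  · change (Gadget.tildeOf Gadget.X2K).trace ^ 2 = _ * (Gadget.tildeOf Gadget.X2K).det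
    rw [Gadget.trace_tildeOf, Gadget.det_tildeOf, sq, ← map_mul, ← map_mul, Gadget.X2K_trace_sq]
  · intro μ hμ m hm
    refine pow_ne_one_of_add_inv_eq_toReal (c := ⟨11, -8⟩) ?_ Gadget.two_lt_toConj_eleven hm
    rw [hμ, map_add, K5.toComplex_ofPhi, map_ofNat]; ring
  · intro h
    have e := congrArg (fun U : U2 => (U : M2)) h
    simp only [Submonoid.coe_mul] at e
    change Gadget.tildeOf Gadget.Y2K * Gadget.tildeOf Gadget.X2K = Gadget.tildeOf Gadget.X2K * Gadget.tildeOf Gadget.Y2K at e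
    rw [← Gadget.tildeOf_mul, ← Gadget.tildeOf_mul] at e
    exact Gadget.Y2K_mul_X2K_ne (Gadget.tildeOf_injective e)
  · intro h
    rw [Gadget.X2U_det, one_smul] at h
    change Gadget.tildeOf Gadget.Y2K * Gadget.tildeOf Gadget.X2K * star (Gadget.tildeOf Gadget.Y2K) = star (Gadget.tildeOf Gadget.X2K) at h
    rw [Gadget.star_tildeOf_eq Gadget.Y2U.2 Gadget.Y2K_mul_inv, Gadget.star_tildeOf_eq Gadget.X2U.2 Gadget.X2K_mul_inv,
      ← Gadget.tildeOf_mul, ← Gadget.tildeOf_mul] at h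
    exact Gadget.Y2K_conj_X2K_ne (Gadget.tildeOf_injective h)

/-- **The gadget net exists.** [cite: AharonovArad2011, §3.3] -/
theorem exists_isNet₂ : ∃ l₀ : ℕ, IsNet E₂ (netOf E₂ l₀) := by
  obtain ⟨htr, hroot, hcomm, hconj⟩ := criterion₂
  obtain ⟨l₀, hl₀⟩ := exists_length_forall_wordApprox_pair Gadget.X2U Gadget.Y2U Gadget.X2U_det Gadget.Y2U_det _ htr hroot
    hcomm hconj (ε₀ := 1 / 200) (by norm_num)
  refine ⟨l₀, isNet_netOf E₂ invLaw₂ fun U => ?_⟩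
  rw [genSet₂_eq]; exact hl₀ U

/-- **The gadget seed exists.** [cite: AharonovArad2011, §3.3] -/
theorem exists_seed₂ : ∃ w : List Letter,
    1 / 25 ≤ chord E₂ (wordCand E₂ w) (wf_wordCand E₂ invLaw₂ _) ∧ chord E₂ (wordCand E₂ w) (wf_wordCand E₂ invLaw₂ _) ≤ 3 / 50 := by
  obtain ⟨htr, hroot, hcomm, hconj⟩ := criterion₂
  have hA : ((su2ToU2 (torus (1 / 20)) : U2) : M2).det = 1 := (Matrix.mem_specialUnitaryGroup_iff.1 (torus (1 / 20)).2).2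
  obtain ⟨w', hw', hnorm⟩ := exists_word_near_of_det_eq_one Gadget.X2U Gadget.Y2U _ htr hroot hcomm hconj
    (su2ToU2 (torus (1 / 20))) hA (ε := 1 / 1000) (by norm_num)
  have hlift : ∀ w' : List U2, (∀ a ∈ w', a ∈ ({Gadget.X2U, Gadget.Y2U, Gadget.X2U⁻¹, Gadget.Y2U⁻¹} : Set U2)) →
      ∃ w : List Letter, ((evS E₂ (wordCand E₂ w) (wf_wordCand E₂ invLaw₂ _) : SU2) : M2) = ((w'.prod : U2) : M2) := by
    intro w'
    induction w' with
    | nil => intro; exact ⟨[], by simp [wordCand, E₂, Gadget.tildeOf_one]⟩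
    | cons a w' ih =>
      intro hall
      obtain ⟨w, hw⟩ := ih (fun b hb => hall b (by simp [hb]))
      have ha := hall a (by simp)
      simp only [Set.mem_insert_iff, Set.mem_singleton_iff] at ha
      have ex : ∀ γ, ((evS E₂ (wordCand E₂ (γ :: w)) (wf_wordCand E₂ invLaw₂ _) : SU2) : M2) =
          Gadget.tildeOf (mat₂ γ) * ((evS E₂ (wordCand E₂ w) (wf_wordCand E₂ invLaw₂ _) : SU2) : M2) := by
        intro γ
        rw [show γ :: w = [γ] ++ w from rfl, evS_wordCand_append E₂ invLaw₂, Submonoid.coe_mul, coe_evS_wordCand_singleton E₂ invLaw₂]; rfl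
      rcases ha with rfl | rfl | rfl | rfl
      · exact ⟨Letter.x :: w, by rw [ex, hw, List.prod_cons, Submonoid.coe_mul]; rfl⟩
      · exact ⟨Letter.y :: w, by rw [ex, hw, List.prod_cons, Submonoid.coe_mul]; rfl⟩
      · exact ⟨Letter.xi :: w, by
          rw [ex, hw, List.prod_cons, Submonoid.coe_mul, Matrix.UnitaryGroup.inv_apply]
          exact congrArg (· * _) (Gadget.star_tildeOf_eq Gadget.X2U.2 Gadget.X2K_mul_inv).symm⟩
      · exact ⟨Letter.yi :: w, by
          rw [ex, hw, List.prod_cons, Submonoid.coe_mul, Matrix.UnitaryGroup.inv_apply]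
          exact congrArg (· * _) (Gadget.star_tildeOf_eq Gadget.Y2U.2 Gadget.Y2K_mul_inv).symm⟩
  obtain ⟨w, hw⟩ := hlift w' hw'
  refine ⟨w, seed_of_near E₂ invLaw₂ ?_⟩
  rw [hw]; exact hnorm

end ExactCompiler

end Literature.Computability.QuantumComplexity

end
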